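import Summits.QuantumFields.YangMills.Theorems.SwapVirialDeficitSectorLaplaceEndGaussN2Far
import HarnessLib

/-!
# Route `SwapVirialDeficit` (YangMills): TIP CORE, FAR CASE — at a leader point where T1's admissibility fails, the follower integral at ANY hub is an `e^{−bκ_far}` tail
# (cell ym-idea-1, skeleton ➎ v14, `stub_core_tip`: piece (C1) of w3 g68's (hCore) `hubIntegral_hubAt_core_ceiling` (LEAD g99 01:08Z assignment);
# free-hands support of ⟨stmt-QuantumFields-24197⟩ `SwapVirialDeficit.SwapGluedStiffness`)

w3 g67's ✓`endGauss_far_floor` is hub-GENERIC: at every hub `a`, a leader point `((x,y),(z,0))` failing T1's near-flat admissibility (relations `≤ sT`, `F̂ ≤ κf`) has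
`F̂(a, ((x,y),(z,F))) ≥ κ_far = min(sT², κf/(300L⁴))/(3600L⁶)` for EVERY follower configuration `F`.  Hence the follower integral against the follower weight is a pure tail:
★ `tipCore_fibre_far` — `∫⁻_F ofReal(e^{−bF̂(a,((x,y),(z,F)))}·piWeight F) ≤ ofReal(e^{−b·κ_far})·∫⁻_F ofReal(piWeight F)` (`b ≥ 0`; `∫⁻ piWeight ≤ e^{60L⁴}` by
✓`lintegral_piWeight_le_exp`; the leader weights `w(x)w(y)w(z)` of `gnoDensity = w(x)w(y)w(z)·piWeight` ride along unchanged).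
The NEAR case (T1 at full `b`, determinant matched to the apex reference, leader Gaussians with the tip floor form) is (C2).

HONEST LABEL: a tail bound; `stub_core_tip`, ⟨24197⟩ ∕ ⟨24194⟩ OPEN; own crux ⟨22884⟩ `LargeFieldMassRefinementTail` OPEN (blocked-on ⟨19935⟩); the Yang–Mills mass gap is NOT
proved; no summit is proved by a line.  THEOREMS ONLY (0 `def`, 0 `sorry`, no instance), standard axioms.  Width seat ym-line-sfw-p2-w3 g68 (cell ym-idea-1, free hands),
`--supports stmt-QuantumFields-24197`.  References: [cite: Luscher1983, §2]; [folklore].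
-/

set_option autoImplicit false
set_option synthInstance.maxSize 1024

noncomputable section

open MeasureTheory Quaternion Set
open scoped Quaternion BigOperators ENNReal
open Literature.MathematicalPhysics.QuantumLattice
open Literature.MathematicalPhysics.QuantumFieldTheory hiding SU2

namespace Summit.QuantumFields.YangMills.Theorems.SwapVirialDeficit.BlowUpRing

open Summit.QuantumFields.YangMills.Theorems.FemtoTransferGap
open Summit.QuantumFields.YangMills.Theorems.FemtoTransferGap.TT
open Summit.QuantumFields.YangMills.Theorems.VirialFluxGap.RingDeficit
open Summit.QuantumFields.YangMills.Theorems.SwapVirialDeficit.SwapRing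
open Summit.QuantumFields.YangMills.Theorems.SwapVirialDeficit.Gnomonic (normSq3 gnomonicWeight piWeight piWeight_pos piWeight_le_one continuous_piWeight)

variable {L : ℕ} [NeZero L]

/-- ★ **TIP CORE, FAR CASE**: at ANY hub `a`, follower signs `+`, a leader point where T1's admissibility (relations `≤ sT`, flatness `≤ κf`) fails, and `b ≥ 0`:
`∫⁻_F ofReal(e^{−bF̂(a,((x,y),(z,F)))}·piWeight F) ≤ ofReal(e^{−b·κ_far})·∫⁻_F ofReal(piWeight F)`, `κ_far = min(sT², κf/(300L⁴))/(3600L⁶)` (✓`endGauss_far_floor`).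
[cite: Luscher1983, §2] -/
theorem tipCore_fibre_far {a : ℍ} (ε : GnoSign L) (hε : ε.2.2 = fun _ => true) (x y z : Fin 3 → ℝ) {sT κf b : ℝ} (hsT : 0 ≤ sT) (hκf : 0 ≤ κf) (hb : 0 ≤ b)
    (hfar : ¬ ((∀ μ ν : Fin 3, frobNorm ((((blowUpPoint 1 (gnomonicPoint a ε (((x, y), (z, (0 : Fol L → Fin 3 → ℝ))) : GnoCoord L))).1 (Fin.castSucc μ) *
        (blowUpPoint 1 (gnomonicPoint a ε (((x, y), (z, (0 : Fol L → Fin 3 → ℝ))) : GnoCoord L))).1 (Fin.castSucc ν) : SU2) : Matrix (Fin 2) (Fin 2) ℂ) -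
        (((blowUpPoint 1 (gnomonicPoint a ε (((x, y), (z, (0 : Fol L → Fin 3 → ℝ))) : GnoCoord L))).1 (Fin.castSucc ν) *
        (blowUpPoint 1 (gnomonicPoint a ε (((x, y), (z, (0 : Fol L → Fin 3 → ℝ))) : GnoCoord L))).1 (Fin.castSucc μ) : SU2) : Matrix (Fin 2) (Fin 2) ℂ)) ≤ sT) ∧
      (∀ μ : Fin 3, frobNorm ((((blowUpPoint 1 (gnomonicPoint a ε (((x, y), (z, (0 : Fol L → Fin 3 → ℝ))) : GnoCoord L))).1 (Fin.last 3) *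
        (blowUpPoint 1 (gnomonicPoint a ε (((x, y), (z, (0 : Fol L → Fin 3 → ℝ))) : GnoCoord L))).1 (Fin.castSucc (Equiv.swap (0 : Fin 3) 1 μ)) : SU2) :
          Matrix (Fin 2) (Fin 2) ℂ) -
        (((blowUpPoint 1 (gnomonicPoint a ε (((x, y), (z, (0 : Fol L → Fin 3 → ℝ))) : GnoCoord L))).1 (Fin.castSucc μ) *
        (blowUpPoint 1 (gnomonicPoint a ε (((x, y), (z, (0 : Fol L → Fin 3 → ℝ))) : GnoCoord L))).1 (Fin.last 3) : SU2) : Matrix (Fin 2) (Fin 2) ℂ)) ≤ sT) ∧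
      gnoDeficit (fun _ => false) (fun _ => 1) a ε (((x, y), (z, (0 : Fol L → Fin 3 → ℝ))) : GnoCoord L) ≤ κf))
    :
    ∫⁻ F : Fol L → Fin 3 → ℝ, ENNReal.ofReal (Real.exp (-(b * gnoDeficit (fun _ => false) (fun _ => 1) a ε (((x, y), (z, F)) : GnoCoord L))) * piWeight F) ≤
      ENNReal.ofReal (Real.exp (-(b * (min (sT ^ 2) (κf / (300 * (L : ℝ) ^ 4)) / (3600 * (L : ℝ) ^ 6))))) *
        ∫⁻ F : Fol L → Fin 3 → ℝ, ENNReal.ofReal (piWeight F) := by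
  rw [← lintegral_const_mul' _ _ ENNReal.ofReal_ne_top]
  refine lintegral_mono fun F => ?_
  rw [← ENNReal.ofReal_mul (Real.exp_pos _).le]
  refine ENNReal.ofReal_le_ofReal (mul_le_mul_of_nonneg_right ?_ (piWeight_pos F).le)
  have hfloor := endGauss_far_floor (L := L) ε hε x y z hsT hκf hfar F
  exact Real.exp_le_exp.2 (neg_le_neg (mul_le_mul_of_nonneg_left hfloor hb))

end Summit.QuantumFields.YangMills.Theorems.SwapVirialDeficit.BlowUpRing

end
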